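import Summits.AtomisticToContinuum.Crystallization.Theses.ExcessDecayLiouville
import Literature.MathematicalPhysics.StatisticalMechanics.BarlowStacking
import Literature.MathematicalPhysics.StatisticalMechanics.HaggStacking

/-!
# Sketch — crux-ideate CoarseGrains (stmt-AtomisticToContinuum-9331), round 1, ideator 2

First lemmas of the two idea cards, as `def … : Prop` over existing declarations (no proofs):

* card `padding-periodisation-grain-gap`: `GrainGap` (the Transfer C⁺, a rate-free gap over
  `PeriodicConfiguration 3`), `PeriodisationWithWindows` (verbatim signature of FlatToriSuffice's
  support item stmt-11953), `TrialBound` (verbatim signature of line C's `stub_trialBound`), and the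
  first lemma `PaddingBridge : GrainGap → PeriodisationWithWindows → TrialBound → CoarseGrains`.
* card `hagg-parity-involution-surgery`: `FineBarlowGrains η₀` (stacking-agnostic fine grains, the
  card's hypothesis), the first lemma `FewCLayers` (≤ M₀ c-layers in the core of a fine Barlow grain
  of a ground state, M₀ independent of the radius), and the composition target
  `SurgeryBridge : FewCLayers → (∃ η₀ > 0, FineBarlowGrains η₀ ∧ …) → CoarseGrains` (stated only).
-/

noncomputable section

namespace Summit.AtomisticToContinuum.Crystallization.Cruxes.CoarseGrains.IdeatorTwo

open Literature.MathematicalPhysics.StatisticalMechanics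

local notation "E3" => EuclideanSpace ℝ (Fin 3)

/-- The hexagonal period lattice `Λ = ℤu + ℤv + ℤ·2√(2/3)e₃` of the unit hcp stacking (as in the
route file). -/
def hcpΛ : Set E3 :=
  {z | ∃ i j k : ℤ, z = (i : ℝ) • triangularVec₁ 1 + (j : ℝ) • triangularVec₂ 1 +
    (k : ℝ) • layerNormal (2 * Real.sqrt (2 / 3))}

/-- Two-way `ε`-matching of a point set `X` with the affine hcp two-lattice datum `(t, A)` on the
ball `B_r(c)` (the route's `Near`). -/
def Near (X : Set E3) (c : E3) (r : ℝ) (t : Fin 2 → E3) (A : E3 →L[ℝ] E3) (ε : ℝ) : Prop :=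
  (∀ p ∈ X, dist p c ≤ r → ∃ m : Fin 2, ∃ z ∈ hcpΛ, dist p (t m + A z) ≤ ε) ∧
  (∀ m : Fin 2, ∀ z ∈ hcpΛ, dist (t m + A z) c ≤ r → ∃ p ∈ X, dist p (t m + A z) ≤ ε)

/-- Admissible cell (the route's `Adm`). -/
def Adm (A : E3 →L[ℝ] E3) : Prop :=
  ∃ R : E3 ≃ₗᵢ[ℝ] E3, ‖A - (97 / 100 : ℝ) • (R.toContinuousLinearEquiv : E3 →L[ℝ] E3)‖ ≤ 1 / 40

/-- hcp-like inner displacement (the route's `Inner`). -/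
def Inner (t : Fin 2 → E3) (A : E3 →L[ℝ] E3) : Prop :=
  ‖t 1 - t 0 - A (barlowOffset 1 + layerNormal (Real.sqrt (2 / 3)))‖ ≤ 1 / 40

/-- `X` has a coarse hcp grain of radius `R`: some ball `B_R(c)` is two-way `1/40`-matched with an
admissible affine hcp two-lattice with hcp-like inner displacement (the conclusion of the crux). -/
def HasGrain (X : Set E3) (R : ℝ) : Prop :=
  ∃ (c : E3) (t : Fin 2 → E3) (A : E3 →L[ℝ] E3), Adm A ∧ Inner t A ∧ Near X c R t A (1 / 40)

/-! ## Card 1 — padding periodisation: the crux is a grain gap over flat tori -/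

/-- **GrainGap** (Transfer C⁺ of card 1): there is a reference periodic configuration `Q₀` such that
for every separation `δ > 0` and radius `R > 0` there is `c > 0` with: every `δ`-separated periodic
configuration of `ℝ³` WITHOUT a coarse hcp grain of radius `R` has Lennard-Jones energy per
particle at least `e(Q₀) + c`. Rate-free, boundary-free, no particle number. -/
def GrainGap : Prop :=
  ∃ Q₀ : PeriodicConfiguration 3, ∀ δ : ℝ, 0 < δ → ∀ R : ℝ, 0 < R → ∃ c : ℝ, 0 < c ∧
    ∀ Q : PeriodicConfiguration 3,
      (∀ p ∈ Q.points, ∀ q ∈ Q.points, p ≠ q → δ ≤ dist p q) → ¬ HasGrain Q.points R →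
        Q₀.energyPerParticle lennardJones + c ≤ Q.energyPerParticle lennardJones

/-- **PeriodisationWithWindows** — verbatim signature of FlatToriSuffice's support item
stmt-AtomisticToContinuum-11953 (padding periodisation: motif = the configuration, `N e(P) ≤ 𝓔_N(x)`
because Lennard-Jones cross terms beyond distance `1` are `≤ 0`, and windows of radius `R` around
the particles see no periodic image). -/
def PeriodisationWithWindows : Prop :=
  ∀ (N : ℕ) (x : Fin N → E3), 0 < N → Function.Injective x → ∀ R : ℝ,
    ∃ P : PeriodicConfiguration 3, (↑P.motif : Set E3) = Set.range x ∧
      (N : ℝ) * P.energyPerParticle lennardJones ≤ interactionEnergy lennardJones x ∧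
      ∀ i : Fin N, ∀ y ∈ P.points, dist y (x i) ≤ R → y ∈ Set.range x

/-- **TrialBound** — verbatim signature of `stub_trialBound` of line vanishing-excess-truss-rigidity
(trial blocks cut from any periodic configuration: `E(N) ≤ N (e(Q) + η)` eventually). -/
def TrialBound : Prop :=
  ∀ (Q : PeriodicConfiguration 3) (η : ℝ), 0 < η → ∃ N₀ : ℕ, ∀ N : ℕ, N₀ ≤ N →
    groundStateEnergy lennardJones 3 N ≤ (N : ℝ) * (Q.energyPerParticle lennardJones + η)

/-- **First lemma of card 1 (PaddingBridge, provable now, size M):** the grain gap over flat tori,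
padding periodisation with windows and the trial upper bound give the crux BY NAME. Proof sketch:
fix `R`; `δ` from `LennardJonesMinimalDistance_holds`; `c` from `GrainGap`; `N₀` from `TrialBound`
with `η = c/2` at `Q = Q₀`; for a ground state `x` with `N ≥ N₀` periodise with windows of radius
`R + 2`: `e(P) ≤ E(N)/N < e(Q₀) + c`, `P.points` is `δ`-separated (windows), so `P` HAS a grain;
a grain ball of `P` contains a particle within `11/10 + 1/40` of its centre (second matching
clause + `exists_site_near` of the crux's Disproof.lean: covering radius `≤ 11/10` for admissible
data), hence lies in a window of radius `2R + 3`, where `P.points = range x` up to a period: the same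
datum matches `range x` (WLOG `R ≥ 2`). -/
def PaddingBridge : Prop :=
  GrainGap → PeriodisationWithWindows → TrialBound →
    Summit.AtomisticToContinuum.Crystallization.Theses.ExcessDecayLiouville.CoarseGrains

/-! ## Card 2 — Hägg-parity involution surgery: stacking selection inside a finite ground state -/

/-- Two-way `ε`-matching of two point sets on the closed ball `B_r(c)`. -/
def TwoWay (X S : Set E3) (c : E3) (r ε : ℝ) : Prop :=
  (∀ p ∈ X, dist p c ≤ r → ∃ q ∈ S, dist p q ≤ ε) ∧ (∀ q ∈ S, dist q c ≤ r → ∃ p ∈ X, dist p q ≤ ε)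

/-- **FineBarlowGrains η₀** (hypothesis of card 2; stacking-AGNOSTIC): every large Lennard-Jones
ground state contains, for every radius, a ball two-way `η₀`-matched with an ISOMETRIC copy of a
uniform Barlow stacking `barlowStacking a h s` — ANY Hägg word `s` — with cell `(a, h)` in the pinned
relaxed box `|a − 0.97| ≤ 1/80`, `|h − 0.97√(2/3)| ≤ 1/100` (contains `(a*, h*) = (0.9713, 0.7930)`,
crux evidence hcp_relax.py / j007505). -/
def FineBarlowGrains (η₀ : ℝ) : Prop :=
  ∀ R : ℝ, 0 < R → ∃ N₀ : ℕ, ∀ N : ℕ, N₀ ≤ N → ∀ x : Fin N → E3, IsGroundState lennardJones x →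
    ∃ (c : E3) (A : E3 ≃ₗᵢ[ℝ] E3) (v : E3) (a h : ℝ) (s : ℤ → ℤ), IsHaggSeq s ∧
      |a - 97 / 100| ≤ 1 / 80 ∧ |h - 97 / 100 * Real.sqrt (2 / 3)| ≤ 1 / 100 ∧
      TwoWay (Set.range x) ((fun z => A z + v) '' barlowStacking a h s) c R η₀

/-- **First lemma of card 2 (FewCLayers, size L; load-bearing):** there are a tolerance `η₀ > 0`, a
bound `M₀` and a radius `R₀` such that in every Lennard-Jones ground state, on every ball
`B_{R'}(c)`, `R' ≥ R₀`, two-way `η₀`-matched with an isometric relaxed Barlow stacking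
`A(barlowStacking a h s) + v`, the number of c-LAYERS `m` (`s m = s (m-1)`: the shift does not
reverse) crossing the core `B_{R'/2}(c)` is at most `M₀` — INDEPENDENTLY of `R'`. Mechanism: the
Hägg-parity involution — process the c-layers of the core bottom-up and move the block of layers above
each by the in-plane point reflection through a site column of that c-layer's current letter,
re-centred modulo the triangular lattice — moves every block between consecutive c-layers by an
isometry `x ↦ ±x + τ_b`, converts every c-layer of the core to an h-layer and no h-layer to a c-layer,
re-pairs nearest-neighbour interlayer bonds only across the `n_c` converted interfaces (first-order
noise cancels in the layer sums by the 3-fold symmetry of hollow sites; second order `≤ C η₀²` per atom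
there, `C = 6V″(r₁) + 6|V′(r₁)|/r₁ ≤ 86` on the box) and gains the Hägg margin `|J₂| − |J₃| ≥ 5.4e-5`
per atom of each converted layer (`barlowCoupling`); a collar of width 2 of the moved blocks is deleted
and parked far away at cost `≤ C R'²`; minimality of the ground state then bounds
`n_c (γ_H − Cη₀²) · 2.8 R'² ≤ 30 R'²`, whence `M₀ ≈ 2·10⁵` at `η₀ = 1/2000`. -/
def FewCLayers : Prop :=
  ∃ η₀ : ℝ, 0 < η₀ ∧ ∃ M₀ : ℕ, ∃ R₀ : ℝ, ∀ R' : ℝ, R₀ ≤ R' →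
    ∀ (N : ℕ) (x : Fin N → E3), IsGroundState lennardJones x →
      ∀ (c : E3) (A : E3 ≃ₗᵢ[ℝ] E3) (v : E3) (a h : ℝ) (s : ℤ → ℤ), IsHaggSeq s →
        |a - 97 / 100| ≤ 1 / 80 → |h - 97 / 100 * Real.sqrt (2 / 3)| ≤ 1 / 100 →
        TwoWay (Set.range x) ((fun z => A z + v) '' barlowStacking a h s) c R' η₀ →
          {m : ℤ | |(m : ℝ) * h - (A.symm (c - v)) 2| ≤ R' / 2 ∧ s m = s (m - 1)}.ncard ≤ M₀

/-- **Composition target of card 2 (stated only; the crux-plan stage cuts it into stubs):** few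
c-layers + fine Barlow grains at the SAME tolerance (+ the pigeonhole h-run, the geometry "an h-run
of an isometric relaxed Barlow stacking restricted to a ball is an admissible hcp two-lattice ball
with hcp-like inner displacement", and `relaxedSpacing_in_window`-type window lemmas) give the crux
BY NAME. -/
def SurgeryBridge : Prop :=
  FewCLayers →
    (∀ η₀ : ℝ, 0 < η₀ → FineBarlowGrains η₀) →
      Summit.AtomisticToContinuum.Crystallization.Theses.ExcessDecayLiouville.CoarseGrains

/-- Elaboration probe: the crux decl is in scope by name. -/
example : Prop := Summit.AtomisticToContinuum.Crystallization.Theses.ExcessDecayLiouville.CoarseGrains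

end Summit.AtomisticToContinuum.Crystallization.Cruxes.CoarseGrains.IdeatorTwo

end
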